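import Summits.CriticalPhenomena.PercolationContinuityZ3.Theorems.PercNearOneGluingNoHeavyQuantGluedForestsOneTight
import HarnessLib

/-!
# QUANT lane R8, T-DEC: A FOREST WITH AT MOST ONE NON-GOOD SIBLING IS SDEC AS SOON AS THAT SIBLING'S SUB-FOREST IS — the node `SiblingStep` restricted to
# single-core forests holds outright, for siblings of ANY kind (census-1 gen 34; the sibling-type-free form of this seat's one-tight theorems)

builds on p205010 (kernel theorem, internal audit signed; external expert review pending)

Support file (`--supports stmt-CriticalPhenomena-4575`), QUANT lane seat prim-quant-census-1 (gen 34); memo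
`run/shared/lean/prim/quant/prim-quant-census-1/g34/FOREST3-G34.md` §2.  Theorems only (no definitions), standard axioms, no sorries.  Uses `sdec_gate` /
`sdec_mono` (`…QuantSDEC`), `gate_laws` / `lconv_delta_left` (`…QuantGatedConvSplit`), g32's `sdec_append_good` (`…QuantGoodSiblingsCore`: arm-1 g57's
`sdec_cons_of_tame` / `sdec_cons_of_hullHigh` iterated), `sdec_flaw_perm` (`…QuantResidueForestsAll`).

THE PRINCIPLE.  The sibling step fails to be automatic because SDEC is not known to be closed under convolution (`SDECConvClosed`, census-2 g53).  But the
two ADJUNCTION steps in the tree — a TAME sibling (arm-1 g57) and a HULL+HIGH sibling (census-1 g29) beside any SDEC affordable forest — need no convolution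
closure.  So a forest in which every sibling but one is GOOD at the floor `x` (law-OK, affordable `x·M ≤ q·mean`, tame or hull+high) is SDEC at `x` as soon as
the exceptional sibling `s = gate ρ q` is, and THAT is just the SDEC of its own sub-forest law `ρ` at its own floor `x₁` with `x ≤ q·x₁` (`sdec_gate`,
`sdec_mono`) — the tree recursion goes through along a single non-good spine.  This seat's `sdec_gluedForests_of_oneTight` is the instance "sub-forest =
`lo` sure relays carrying one glued block" (`gluedSib_sdec`); census-1 g31's 3-chains, census-2's depth-one trees, the lead's blob spines … are others.
* **`sdec_flaw_singleton`** — one sibling: `s.LawOK`, `SDEC x₁ s.M s.ρ`, `x ≤ s.q·x₁`, `x₁ ≤ 1` ⟹ `SDEC x (ftop [s]) (flaw [s])`.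
* **`sdec_forest_allGood`** — every sibling good at `x` (`0 < x < 1`) ⟹ `SDEC x (ftop L) (flaw L)`.
* **`sdec_forest_singleCore`** — THE NODE-SHAPED FORM: `0 < x < 1`; `Lg` good at `x`; one more sibling `s` (law-OK, affordable) whose sub-forest law is SDEC at a
  floor `x₁ ≤ 1` with `x ≤ s.q·x₁`; every `L ~ Lg ++ [s]` ⟹ `SDEC x (ftop L) (flaw L)`.

HONEST STATUS.  Forests with ≥ 2 non-good siblings are the whole difficulty (`SDECConvClosed` / the hub lemmas); `SiblingStep`, `GluedDominatedMass`,
`SDECConvClosed`, `FarTreeRow` OPEN; RATE class (log\*) / honest sentence of `run/shared/lean/prim/quant/README.md` unchanged.  [this work].  Nothing here is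
cited as a published result.  The gluing rows served [cite: KozmaNitzan2024, Conjecture 3 (p. 15)]; product measure [cite: Grimmett1999, §1.3 p. 10].
-/

noncomputable section

open scoped BigOperators

namespace Summit.CriticalPhenomena.PercolationContinuityZ3.Theorems
namespace Quant
namespace LawDec

open Finset

/-! ### One sibling -/

/-- **one sibling is SDEC at the forest floor if its sub-forest is SDEC at its own floor**: `s.LawOK`, `SDEC x₁ s.M s.ρ`, `x ≤ s.q·x₁`, `x₁ ≤ 1` ⟹
`SDEC x (ftop [s]) (flaw [s])` (`flaw [s] = gate s.ρ s.q`; `sdec_gate` + `sdec_mono`). [this work] -/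
theorem sdec_flaw_singleton {x x₁ : ℝ} (s : Sib) (hs : s.LawOK) (hS : SDEC x₁ s.M s.ρ) (hx : x ≤ s.q * x₁) (hx₁ : x₁ ≤ 1) :
    SDEC x (ftop [s]) (flaw [s]) := by
  obtain ⟨hq0, hq1, ρ0, ρM, ρ1⟩ := hs
  obtain ⟨_, gM, _⟩ := gate_laws s.M s.ρ s.q hq0.le hq1.le ρ0 ρM ρ1
  have e1 : flaw [s] = gate s.ρ s.q := funext fun h => lconv_delta_left 0 _ _ gM h
  have e2 : ftop [s] = s.M := by show 0 + s.M = s.M; omega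
  rw [e1, e2]
  have hqx1 : s.q * x₁ < 1 := by nlinarith
  exact sdec_mono (sdec_gate hS s.q hq0 hq1.le) hx hqx1

/-! ### No core, one core -/

/-- **a forest all of whose siblings are GOOD at `x` is SDEC at `x`** (`0 < x < 1`; good = law-OK, affordable, tame or hull+high). [this work] -/
theorem sdec_forest_allGood {x : ℝ} (hx0 : 0 < x) (hx1 : x < 1) (L : List Sib)
    (hL : ∀ s ∈ L, s.LawOK ∧ x * (s.M : ℝ) ≤ s.q * s.mean ∧
      ((∀ h : ℕ, 1 ≤ h → s.ρ h ≠ 0 → s.q * s.mean ≤ 2 * h ∨ x * ((s.M : ℝ) - h) ≤ s.q * s.mean - h) ∨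
        HullHigh x (s.q * s.mean) s.M (gate s.ρ s.q))) :
    SDEC x (ftop L) (flaw L) := by
  have h0 : SDEC x (ftop []) (flaw []) := by intro q _ _ j' hj'; exact absurd hj' (Nat.not_lt_zero _)
  have h := sdec_append_good hx0 hx1 [] (fun t ht => by simp at ht) (fun t ht => by simp at ht) h0 L (fun s hs => (hL s hs).1)
    (fun s hs => (hL s hs).2.1) (fun s hs => (hL s hs).2.2)
  simpa using h

/-- **THE SIBLING STEP FOR SINGLE-CORE FORESTS — NO ORACLE, ANY SIBLING TYPES.**  `0 < x < 1`; `Lg` any list of siblings GOOD at `x` (law-OK, `x·M ≤ q·mean`,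
tame or hull+high — any sub-trees); one more sibling `s` (law-OK, `x·M ≤ q·mean`) whose sub-forest law is SDEC at a floor `x₁ ≤ 1` with `x ≤ s.q·x₁`; every
forest `L ~ Lg ++ [s]` ⟹ `SDEC x (ftop L) (flaw L)`. [this work] -/
theorem sdec_forest_singleCore {x x₁ : ℝ} (hx0 : 0 < x) (hx1 : x < 1) (Lg L : List Sib) (s : Sib)
    (hLg : ∀ t ∈ Lg, t.LawOK ∧ x * (t.M : ℝ) ≤ t.q * t.mean ∧
      ((∀ h : ℕ, 1 ≤ h → t.ρ h ≠ 0 → t.q * t.mean ≤ 2 * h ∨ x * ((t.M : ℝ) - h) ≤ t.q * t.mean - h) ∨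
        HullHigh x (t.q * t.mean) t.M (gate t.ρ t.q)))
    (hs : s.LawOK) (hxs : x * (s.M : ℝ) ≤ s.q * s.mean) (hS : SDEC x₁ s.M s.ρ) (hx : x ≤ s.q * x₁) (hx₁ : x₁ ≤ 1)
    (hperm : (Lg ++ [s]).Perm L) :
    SDEC x (ftop L) (flaw L) := by
  refine sdec_flaw_perm hperm ?_
  exact sdec_append_good hx0 hx1 [s] (fun t ht => by simp at ht; subst ht; exact hs) (fun t ht => by simp at ht; subst ht; exact hxs)
    (sdec_flaw_singleton s hs hS hx hx₁) Lg (fun t ht => (hLg t ht).1) (fun t ht => (hLg t ht).2.1) (fun t ht => (hLg t ht).2.2)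

end LawDec
end Quant
end Summit.CriticalPhenomena.PercolationContinuityZ3.Theorems
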